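import Summits.QuantumFields.YangMills.Theorems.BalabanUVNodesPortS1Sect4AtRecordPkg

/-!
# NODE O port, row PT-A-2 S4 — LOCALITY OF THE CHART DERIVATIVES: if the functional `ℰ` reads only the bonds issuing from a site set `W` ([I] (1.7) p. 261 «depends on U_j restricted to
# X»; p. 290 «the sums over y are restricted to supp B ⊂ supp ζ̃_□»), then every derivative `Dⁿ(expChart ℰ ρ)(0)(u₁, …, uₙ)` reads only `uᵢ|_W` — the generic tool that lets print's
# (4.23) affine gauge function `λ_x` and the constant field `B(x)` be used INSIDE a window of a torus functional (where a global affine function does not exist)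

CITATION HEADER.  [I] = [Balaban1987RG1]: (1.7) p. 261, (4.19) p. 285 («defined on a neighborhood of □̃»), (4.23) p. 286, p. 290.  Porter PT-A-2 (`ymgap-nodeO-port-PTA-2`), `--supports
stmt-QuantumFields-27930 --as helper`.  REUSED BY NAME: Mathlib `ContinuousLinearMap.iteratedFDerivWithin_comp_right`, `iteratedFDerivWithin_of_isOpen`, `iteratedFDeriv_two_apply`, the lineage's
`B12WardSecond415.iteratedFDeriv_three_apply`, `B12WardThird415.iteratedFDeriv_four_apply`.
WHAT IS PROVED (0 sorry, 0 def; the restriction `P_W B := (ν, y) ↦ if y ∈ W then B_ν(y) else 0` enters as an explicit continuous linear map built inside the proofs and is displayed in the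
statements through `Set.indicator`): `expChart_eq_of_local` (`f B = f B′` when `B = B′` on `W`), ★ `iteratedFDeriv_expChart_eq_of_local` (`Dⁿf(0) m = Dⁿf(0) m′` when `mᵢ = m′ᵢ` on `W`, `f` `Cⁿ`
at `0`), and the curried forms `fderiv²∕³∕⁴_expChart_eq_of_local` used by (4.29)∕(4.31)-type identities.
HONEST FRAMING.  Calculus bookkeeping; nothing of Bałaban's estimates asserted, ported or discharged; 27930 signed-open (⁸-Ax-LR4), no claim held; finite 𝕋⁴ at fixed ε — NOT continuum∕OS∕Clay;
the Yang–Mills mass gap is NOT proved by any of this.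
-/

noncomputable section

open scoped Topology

namespace Summit.QuantumFields.YangMills.Theorems.BalabanUVNodesPortS1

open Filter Set
open NormedSpace (exp)
open Literature.MathematicalPhysics.QuantumFieldTheory.Balaban1983to89.B12PolarizationTensor120 (expChart expChart_apply)
open Literature.MathematicalPhysics.QuantumFieldTheory.Balaban1983to89.B12WardSecond415 (iteratedFDeriv_three_apply)
open Literature.MathematicalPhysics.QuantumFieldTheory.Balaban1983to89.B12WardThird415 (iteratedFDeriv_four_apply)

section Locality

variable {𝔄 : Type*} [NormedRing 𝔄] [NormedAlgebra ℝ 𝔄] {Λ T V F : Type*} [Fintype Λ] [Fintype T]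
  [NormedAddCommGroup V] [NormedSpace ℝ V] [NormedAddCommGroup F] [NormedSpace ℝ F]

omit [Fintype Λ] [Fintype T] in
/-- The restriction-to-`W` projection of unit-lattice fields as a continuous linear map (explicit; no definition is introduced — it is rebuilt where used). [folklore] -/
private theorem exists_projCLM (W : Set T) [DecidablePred (· ∈ W)] :
    ∃ P : (Λ → T → V) →L[ℝ] (Λ → T → V), ∀ B ν y, P B ν y = if y ∈ W then B ν y else 0 := by
  refine ⟨{ toFun := fun B ν y => if y ∈ W then B ν y else 0
            map_add' := fun B B' => by funext ν y; by_cases hy : y ∈ W <;> simp [hy]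
            map_smul' := fun c B => by funext ν y; by_cases hy : y ∈ W <;> simp [hy]
            cont := ?_ }, fun B ν y => rfl⟩
  refine continuous_pi fun ν => continuous_pi fun y => ?_
  by_cases hy : y ∈ W
  · simp only [hy, if_true]; exact (continuous_apply y).comp (continuous_apply ν)
  · simp only [hy, if_false]; exact continuous_const

omit [Fintype Λ] [Fintype T] [NormedAddCommGroup F] [NormedSpace ℝ F] in
/-- **`f(B) = f(B′)` when `B = B′` on `W`** for `f = expChart ℰ ρ` and `ℰ` reading only the bonds from `W`. [cite: Balaban1987RG1, (1.7) p.261] -/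
theorem expChart_eq_of_local {ℰ : (Λ → T → 𝔄) → F} (ρ : V →L[ℝ] 𝔄) (W : Set T)
    (hloc : ∀ U U' : Λ → T → 𝔄, (∀ ν, ∀ y ∈ W, U ν y = U' ν y) → ℰ U = ℰ U') {B B' : Λ → T → V} (h : ∀ ν, ∀ y ∈ W, B ν y = B' ν y) :
    expChart ℰ ρ B = expChart ℰ ρ B' := by
  rw [expChart_apply, expChart_apply]
  exact hloc _ _ fun ν y hy => by rw [h ν y hy]

/-- **★ LOCALITY OF ALL DERIVATIVES AT `0`**: if `ℰ` reads only the bonds from `W` and `f = expChart ℰ ρ` is `Cⁿ` at `0`, then `Dⁿf(0)(m₁, …, mₙ) = Dⁿf(0)(m′₁, …, m′ₙ)` whenever `mᵢ = m′ᵢ` on `W`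
(`f = f ∘ P_W` with `P_W` the continuous linear restriction, chain rule `ContinuousLinearMap.iteratedFDerivWithin_comp_right` on a `Cⁿ`-neighbourhood of `0`). [cite: Balaban1987RG1, (1.7) p.261, p.290] -/
theorem iteratedFDeriv_expChart_eq_of_local {ℰ : (Λ → T → 𝔄) → F} (ρ : V →L[ℝ] 𝔄) (W : Set T)
    (hloc : ∀ U U' : Λ → T → 𝔄, (∀ ν, ∀ y ∈ W, U ν y = U' ν y) → ℰ U = ℰ U') {n : ℕ} (hC : ContDiffAt ℝ n (expChart ℰ ρ) 0)
    {m m' : Fin n → (Λ → T → V)} (hm : ∀ i ν, ∀ y ∈ W, m i ν y = m' i ν y) :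
    iteratedFDeriv ℝ n (expChart ℰ ρ) 0 m = iteratedFDeriv ℝ n (expChart ℰ ρ) 0 m' := by
  classical
  obtain ⟨P, hP⟩ := exists_projCLM (Λ := Λ) (V := V) W
  set f := expChart ℰ ρ with hf
  -- `f = f ∘ P`
  have hfP : f = f ∘ P := by
    funext B
    refine expChart_eq_of_local ρ W hloc fun ν y hy => ?_
    rw [hP, if_pos hy]
  have hP0 : P 0 = 0 := map_zero P
  have hPm : (fun i => P (m i)) = fun i => P (m' i) := by
    funext i; ext ν y
    rw [hP, hP]
    by_cases hy : y ∈ W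
    · rw [if_pos hy, if_pos hy, hm i ν y hy]
    · rw [if_neg hy, if_neg hy]
  -- a `Cⁿ` open neighbourhood of `0`
  obtain ⟨u, hu_open, h0u, hu⟩ := hC.contDiffOn' le_rfl (by simp)
  have hs : insert (0 : Λ → T → V) univ ∩ u = u := by simp
  rw [hs] at hu
  have hpre_open : IsOpen (P ⁻¹' u) := hu_open.preimage P.continuous
  have h0pre : (0 : Λ → T → V) ∈ P ⁻¹' u := by show P 0 ∈ u; rw [hP0]; exact h0u
  have hkey : ∀ m₀ : Fin n → (Λ → T → V), iteratedFDeriv ℝ n f 0 m₀ = iteratedFDeriv ℝ n f 0 (fun i => P (m₀ i)) := by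
    intro m₀
    have h1 : iteratedFDeriv ℝ n f 0 m₀ = iteratedFDeriv ℝ n (f ∘ P) 0 m₀ := by rw [← hfP]
    have h2 : iteratedFDeriv ℝ n (f ∘ P) 0 = iteratedFDerivWithin ℝ n (f ∘ P) (P ⁻¹' u) 0 :=
      ((iteratedFDerivWithin_of_isOpen n hpre_open) h0pre).symm
    have h3 := P.iteratedFDerivWithin_comp_right (f := f) hu hu_open.uniqueDiffOn hpre_open.uniqueDiffOn (x := 0) (by rw [hP0]; exact h0u) (i := n) le_rfl
    have h4 : iteratedFDerivWithin ℝ n f u (P 0) = iteratedFDeriv ℝ n f 0 := by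
      rw [hP0]; exact (iteratedFDerivWithin_of_isOpen n hu_open) h0u
    rw [h1, h2, h3, ContinuousMultilinearMap.compContinuousLinearMap_apply, h4]
  rw [hkey m, hkey m', hPm]

/-- Second derivatives read only `W`: `D²f(0)(u, w) = D²f(0)(u′, w′)`. [cite: Balaban1987RG1, (1.7) p.261, (1.20) p.264] -/
theorem fderiv₂_expChart_eq_of_local {ℰ : (Λ → T → 𝔄) → F} (ρ : V →L[ℝ] 𝔄) (W : Set T)
    (hloc : ∀ U U' : Λ → T → 𝔄, (∀ ν, ∀ y ∈ W, U ν y = U' ν y) → ℰ U = ℰ U') (hC : ContDiffAt ℝ 2 (expChart ℰ ρ) 0)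
    {u u' w w' : Λ → T → V} (hu : ∀ ν, ∀ y ∈ W, u ν y = u' ν y) (hw : ∀ ν, ∀ y ∈ W, w ν y = w' ν y) :
    fderiv ℝ (fderiv ℝ (expChart ℰ ρ)) 0 u w = fderiv ℝ (fderiv ℝ (expChart ℰ ρ)) 0 u' w' := by
  have h := iteratedFDeriv_expChart_eq_of_local ρ W hloc hC (m := ![u, w]) (m' := ![u', w'])
    (fun i ν y hy => by fin_cases i <;> simp [hu ν y hy, hw ν y hy])
  simpa only [iteratedFDeriv_two_apply, Matrix.cons_val_zero, Matrix.cons_val_one, Matrix.head_cons] using h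

/-- Third derivatives read only `W`. [cite: Balaban1987RG1, (1.7) p.261, (4.19) p.285] -/
theorem fderiv₃_expChart_eq_of_local {ℰ : (Λ → T → 𝔄) → F} (ρ : V →L[ℝ] 𝔄) (W : Set T)
    (hloc : ∀ U U' : Λ → T → 𝔄, (∀ ν, ∀ y ∈ W, U ν y = U' ν y) → ℰ U = ℰ U') (hC : ContDiffAt ℝ 3 (expChart ℰ ρ) 0)
    {u u' v v' w w' : Λ → T → V} (hu : ∀ ν, ∀ y ∈ W, u ν y = u' ν y) (hv : ∀ ν, ∀ y ∈ W, v ν y = v' ν y) (hw : ∀ ν, ∀ y ∈ W, w ν y = w' ν y) :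
    fderiv ℝ (fderiv ℝ (fderiv ℝ (expChart ℰ ρ))) 0 u v w = fderiv ℝ (fderiv ℝ (fderiv ℝ (expChart ℰ ρ))) 0 u' v' w' := by
  have h := iteratedFDeriv_expChart_eq_of_local ρ W hloc hC (m := ![u, v, w]) (m' := ![u', v', w'])
    (fun i ν y hy => by fin_cases i <;> simp [hu ν y hy, hv ν y hy, hw ν y hy])
  rw [iteratedFDeriv_three_apply, iteratedFDeriv_three_apply] at h
  simpa using h

-- (the quadruply nested operator space over the iterated `Pi` type: one more level of pending instance synthesis)
set_option maxSynthPendingDepth 3 in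
/-- Fourth derivatives read only `W`. [cite: Balaban1987RG1, (1.7) p.261, (4.19) p.285] -/
theorem fderiv₄_expChart_eq_of_local {ℰ : (Λ → T → 𝔄) → F} (ρ : V →L[ℝ] 𝔄) (W : Set T)
    (hloc : ∀ U U' : Λ → T → 𝔄, (∀ ν, ∀ y ∈ W, U ν y = U' ν y) → ℰ U = ℰ U') (hC : ContDiffAt ℝ 4 (expChart ℰ ρ) 0)
    {u₁ u₁' u₂ u₂' u₃ u₃' u₄ u₄' : Λ → T → V} (h₁ : ∀ ν, ∀ y ∈ W, u₁ ν y = u₁' ν y) (h₂ : ∀ ν, ∀ y ∈ W, u₂ ν y = u₂' ν y)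
    (h₃ : ∀ ν, ∀ y ∈ W, u₃ ν y = u₃' ν y) (h₄ : ∀ ν, ∀ y ∈ W, u₄ ν y = u₄' ν y) :
    fderiv ℝ (fderiv ℝ (fderiv ℝ (fderiv ℝ (expChart ℰ ρ)))) 0 u₁ u₂ u₃ u₄ =
      fderiv ℝ (fderiv ℝ (fderiv ℝ (fderiv ℝ (expChart ℰ ρ)))) 0 u₁' u₂' u₃' u₄' := by
  have h := iteratedFDeriv_expChart_eq_of_local ρ W hloc hC (m := ![u₁, u₂, u₃, u₄]) (m' := ![u₁', u₂', u₃', u₄'])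
    (fun i ν y hy => by fin_cases i <;> simp [h₁ ν y hy, h₂ ν y hy, h₃ ν y hy, h₄ ν y hy])
  rw [iteratedFDeriv_four_apply, iteratedFDeriv_four_apply] at h
  simpa using h

end Locality

end Summit.QuantumFields.YangMills.Theorems.BalabanUVNodesPortS1

end
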